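import Summits.ValiantsHypothesis.ValiantsHypothesis.Theorems.KPlusLogSqLawStaticPathSlots

/-!
# Route «KPlusLogSqLaw» — parametric max-weight independent set on a path: SLOT ALTERNATION, the count — hops ≤ jumps + masked⁺ + 2(n+1)

HONEST FRAMING.  Helper toward the crux `WeakLifting` (item `stmt-ValiantsHypothesis-19561`, route `KPlusLogSqLaw`, cell `pub-symmetroid`,
seat val-sym-lift-p4 g21, 2026-08-29) on the line of its witness-plan stub `stub_tridiagonalSectorB` (tropical twin of the STATIC tridiagonal
sector = parametric maximum-weight independent set on a path).  The counting half of `…StaticPathSlots` (memo STEPS-AND-CROSSINGS §2b): in the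
event vocabulary of THEOREM T (pairs `p < q ≤ n` with (M), (L), (R) written with the signed `gap` at the crossing abscissa), the HOPS (`p + q` even)
number at most the JUMPS (`p + q` odd) plus the MASKED⁺ pairs plus `2 (n + 1)` (**`hops_le_jumps_add_masked`**), where a masked⁺ pair is a mixed
pair with (M) and (R) but NOT (L) whose slot (sign of the gap slope along `p`) carries a hop `(p, k)`, `k < q`, with no R-flip of the slot strictly
between `k` and `q` — the next flip after a hop is a jump unless (L) fails there (`parity_ne_of_nextFlip`), the map hop ↦ next flip is injective,
and the hops that are the last flip of their slot are at most one per slot.  With THEOREM T (`mixedEvents_card_le`, jumps ≤ 2n):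
**`hops_le_masked`**: `#hops ≤ 4n + 2 + #masked⁺`, so `bp = O(n)` would follow from «masked⁺ = O(n)» (located ≈ 0.7 n under direct annealing,
≤ 6 on all located maximisers n ≤ 24).  Statements about a labelled line arrangement; nothing here asserts anything about `WeakLifting`,
`TropicalB`, `KPlusLogSqLaw`, the stub in its window, `MatrixDescartes` (stmt-ValiantsHypothesis-18050) or `VP ≠ VNP`; the ORDER QUESTION stays open.
-/

set_option linter.dupNamespace false
set_option autoImplicit false

namespace Summit.ValiantsHypothesis.ValiantsHypothesis.Theorems.KPlusLogSqLaw

open Finset Classical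

namespace StaticPathFold

noncomputable section

variable (a b : ℕ → ℝ)

/-- **SLOT ALTERNATION COUNT: `#hops ≤ #jumps + #masked⁺ + 2(n+1)`** (lines `0..n` with pairwise distinct slopes and no third line through a
crossing; hops / jumps = events of THEOREM T's vocabulary with `p + q` even / odd; masked⁺ as in the module docstring). [folklore] -/
theorem hops_le_jumps_add_masked (n : ℕ)
    (hslope : ∀ u v, u ≤ n → v ≤ n → u ≠ v → a u ≠ a v)
    (hgp : ∀ u v t, u ≤ n → v ≤ n → t ≤ n → u ≠ v → t ≠ u → t ≠ v →
      L a b t ((b v - b u) / (a u - a v)) ≠ L a b u ((b v - b u) / (a u - a v))) :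
    (((range (n + 1)) ×ˢ (range (n + 1))).filter (fun pq : ℕ × ℕ => pq.1 < pq.2 ∧ pq.2 ≤ n ∧ Even (pq.1 + pq.2) ∧
        (∀ t, pq.1 < t → t < pq.2 → 0 < gap t (L a b pq.1 ((b pq.2 - b pq.1) / (a pq.1 - a pq.2))) (L a b t ((b pq.2 - b pq.1) / (a pq.1 - a pq.2)))) ∧
        (∃ r, Even r ∧ r ≤ pq.1 ∧ (∀ t, pq.1 - r ≤ t → t < pq.1 → 0 < gap t (L a b pq.1 ((b pq.2 - b pq.1) / (a pq.1 - a pq.2))) (L a b t ((b pq.2 - b pq.1) / (a pq.1 - a pq.2)))) ∧ (r = pq.1 ∨ ¬ 0 < gap (pq.1 - r - 1) (L a b pq.1 ((b pq.2 - b pq.1) / (a pq.1 - a pq.2))) (L a b (pq.1 - r - 1) ((b pq.2 - b pq.1) / (a pq.1 - a pq.2))))) ∧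
        (∃ r, Even r ∧ pq.2 + r ≤ n ∧ (∀ t, pq.2 < t → t ≤ pq.2 + r → 0 < gap t (L a b pq.1 ((b pq.2 - b pq.1) / (a pq.1 - a pq.2))) (L a b t ((b pq.2 - b pq.1) / (a pq.1 - a pq.2)))) ∧ (pq.2 + r = n ∨ ¬ 0 < gap (pq.2 + r + 1) (L a b pq.1 ((b pq.2 - b pq.1) / (a pq.1 - a pq.2))) (L a b (pq.2 + r + 1) ((b pq.2 - b pq.1) / (a pq.1 - a pq.2))))))).card ≤
      (((range (n + 1)) ×ˢ (range (n + 1))).filter (fun pq : ℕ × ℕ => pq.1 < pq.2 ∧ pq.2 ≤ n ∧ Odd (pq.1 + pq.2) ∧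
        (∀ t, pq.1 < t → t < pq.2 → 0 < gap t (L a b pq.1 ((b pq.2 - b pq.1) / (a pq.1 - a pq.2))) (L a b t ((b pq.2 - b pq.1) / (a pq.1 - a pq.2)))) ∧
        (∃ r, Even r ∧ r ≤ pq.1 ∧ (∀ t, pq.1 - r ≤ t → t < pq.1 → 0 < gap t (L a b pq.1 ((b pq.2 - b pq.1) / (a pq.1 - a pq.2))) (L a b t ((b pq.2 - b pq.1) / (a pq.1 - a pq.2)))) ∧ (r = pq.1 ∨ ¬ 0 < gap (pq.1 - r - 1) (L a b pq.1 ((b pq.2 - b pq.1) / (a pq.1 - a pq.2))) (L a b (pq.1 - r - 1) ((b pq.2 - b pq.1) / (a pq.1 - a pq.2))))) ∧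
        (∃ r, Even r ∧ pq.2 + r ≤ n ∧ (∀ t, pq.2 < t → t ≤ pq.2 + r → 0 < gap t (L a b pq.1 ((b pq.2 - b pq.1) / (a pq.1 - a pq.2))) (L a b t ((b pq.2 - b pq.1) / (a pq.1 - a pq.2)))) ∧ (pq.2 + r = n ∨ ¬ 0 < gap (pq.2 + r + 1) (L a b pq.1 ((b pq.2 - b pq.1) / (a pq.1 - a pq.2))) (L a b (pq.2 + r + 1) ((b pq.2 - b pq.1) / (a pq.1 - a pq.2))))))).card +
      (((range (n + 1)) ×ˢ (range (n + 1))).filter (fun pq : ℕ × ℕ => pq.1 < pq.2 ∧ pq.2 ≤ n ∧ Odd (pq.1 + pq.2) ∧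
        (∀ t, pq.1 < t → t < pq.2 → 0 < gap t (L a b pq.1 ((b pq.2 - b pq.1) / (a pq.1 - a pq.2))) (L a b t ((b pq.2 - b pq.1) / (a pq.1 - a pq.2)))) ∧
        ¬ (∃ r, Even r ∧ r ≤ pq.1 ∧ (∀ t, pq.1 - r ≤ t → t < pq.1 → 0 < gap t (L a b pq.1 ((b pq.2 - b pq.1) / (a pq.1 - a pq.2))) (L a b t ((b pq.2 - b pq.1) / (a pq.1 - a pq.2)))) ∧ (r = pq.1 ∨ ¬ 0 < gap (pq.1 - r - 1) (L a b pq.1 ((b pq.2 - b pq.1) / (a pq.1 - a pq.2))) (L a b (pq.1 - r - 1) ((b pq.2 - b pq.1) / (a pq.1 - a pq.2))))) ∧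
        (∃ r, Even r ∧ pq.2 + r ≤ n ∧ (∀ t, pq.2 < t → t ≤ pq.2 + r → 0 < gap t (L a b pq.1 ((b pq.2 - b pq.1) / (a pq.1 - a pq.2))) (L a b t ((b pq.2 - b pq.1) / (a pq.1 - a pq.2)))) ∧ (pq.2 + r = n ∨ ¬ 0 < gap (pq.2 + r + 1) (L a b pq.1 ((b pq.2 - b pq.1) / (a pq.1 - a pq.2))) (L a b (pq.2 + r + 1) ((b pq.2 - b pq.1) / (a pq.1 - a pq.2))))) ∧
        ∃ k, pq.1 < k ∧ k < pq.2 ∧ Even (pq.1 + k) ∧ (∀ t, pq.1 < t → t < k → 0 < gap t (L a b pq.1 ((b k - b pq.1) / (a pq.1 - a k))) (L a b t ((b k - b pq.1) / (a pq.1 - a k)))) ∧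
          (∃ r, Even r ∧ r ≤ pq.1 ∧ (∀ t, pq.1 - r ≤ t → t < pq.1 → 0 < gap t (L a b pq.1 ((b k - b pq.1) / (a pq.1 - a k))) (L a b t ((b k - b pq.1) / (a pq.1 - a k)))) ∧ (r = pq.1 ∨ ¬ 0 < gap (pq.1 - r - 1) (L a b pq.1 ((b k - b pq.1) / (a pq.1 - a k))) (L a b (pq.1 - r - 1) ((b k - b pq.1) / (a pq.1 - a k))))) ∧
          (∃ r, Even r ∧ k + r ≤ n ∧ (∀ t, k < t → t ≤ k + r → 0 < gap t (L a b pq.1 ((b k - b pq.1) / (a pq.1 - a k))) (L a b t ((b k - b pq.1) / (a pq.1 - a k)))) ∧ (k + r = n ∨ ¬ 0 < gap (k + r + 1) (L a b pq.1 ((b k - b pq.1) / (a pq.1 - a k))) (L a b (k + r + 1) ((b k - b pq.1) / (a pq.1 - a k))))) ∧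
          ((0 < (if Even k then a k - a pq.1 else a pq.1 - a k)) ↔ (0 < (if Even pq.2 then a pq.2 - a pq.1 else a pq.1 - a pq.2))) ∧
          ∀ o, k < o → o < pq.2 → (∀ t, pq.1 < t → t < o → 0 < gap t (L a b pq.1 ((b o - b pq.1) / (a pq.1 - a o))) (L a b t ((b o - b pq.1) / (a pq.1 - a o)))) → ((0 < (if Even o then a o - a pq.1 else a pq.1 - a o)) ↔ (0 < (if Even pq.2 then a pq.2 - a pq.1 else a pq.1 - a pq.2))) → ¬ (∃ r, Even r ∧ o + r ≤ n ∧ (∀ t, o < t → t ≤ o + r → 0 < gap t (L a b pq.1 ((b o - b pq.1) / (a pq.1 - a o))) (L a b t ((b o - b pq.1) / (a pq.1 - a o)))) ∧ (o + r = n ∨ ¬ 0 < gap (o + r + 1) (L a b pq.1 ((b o - b pq.1) / (a pq.1 - a o))) (L a b (o + r + 1) ((b o - b pq.1) / (a pq.1 - a o))))))).card + 2 * (n + 1) := by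
  -- abbreviations
  set Cr : ℕ → ℕ → ℝ := fun p q => (b q - b p) / (a p - a q) with hCr
  set G : ℕ → ℕ → ℕ → Prop := fun p q t => 0 < gap t (L a b p (Cr p q)) (L a b t (Cr p q)) with hG
  set Mc : ℕ → ℕ → Prop := fun p q => ∀ t, p < t → t < q → G p q t with hMc
  set Lc : ℕ → ℕ → Prop := fun p q => ∃ r, Even r ∧ r ≤ p ∧ (∀ t, p - r ≤ t → t < p → G p q t) ∧ (r = p ∨ ¬ G p q (p - r - 1)) with hLc
  set Rc : ℕ → ℕ → Prop := fun p q => ∃ r, Even r ∧ q + r ≤ n ∧ (∀ t, q < t → t ≤ q + r → G p q t) ∧ (q + r = n ∨ ¬ G p q (q + r + 1)) with hRc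
  set Sl : ℕ → ℕ → Prop := fun p q => 0 < (if Even q then a q - a p else a p - a q) with hSl
  set P : Finset (ℕ × ℕ) := (range (n + 1)) ×ˢ (range (n + 1)) with hP
  show (P.filter (fun pq => pq.1 < pq.2 ∧ pq.2 ≤ n ∧ Even (pq.1 + pq.2) ∧ Mc pq.1 pq.2 ∧ Lc pq.1 pq.2 ∧ Rc pq.1 pq.2)).card ≤
    (P.filter (fun pq => pq.1 < pq.2 ∧ pq.2 ≤ n ∧ Odd (pq.1 + pq.2) ∧ Mc pq.1 pq.2 ∧ Lc pq.1 pq.2 ∧ Rc pq.1 pq.2)).card +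
    (P.filter (fun pq => pq.1 < pq.2 ∧ pq.2 ≤ n ∧ Odd (pq.1 + pq.2) ∧ Mc pq.1 pq.2 ∧ ¬ Lc pq.1 pq.2 ∧ Rc pq.1 pq.2 ∧
      ∃ k, pq.1 < k ∧ k < pq.2 ∧ Even (pq.1 + k) ∧ Mc pq.1 k ∧ Lc pq.1 k ∧ Rc pq.1 k ∧ (Sl pq.1 k ↔ Sl pq.1 pq.2) ∧
        ∀ o, k < o → o < pq.2 → Mc pq.1 o → (Sl pq.1 o ↔ Sl pq.1 pq.2) → ¬ Rc pq.1 o)).card + 2 * (n + 1)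
  set Hop := P.filter (fun pq => pq.1 < pq.2 ∧ pq.2 ≤ n ∧ Even (pq.1 + pq.2) ∧ Mc pq.1 pq.2 ∧ Lc pq.1 pq.2 ∧ Rc pq.1 pq.2) with hHop
  set Jump := P.filter (fun pq => pq.1 < pq.2 ∧ pq.2 ≤ n ∧ Odd (pq.1 + pq.2) ∧ Mc pq.1 pq.2 ∧ Lc pq.1 pq.2 ∧ Rc pq.1 pq.2) with hJump
  set Msk := P.filter (fun pq => pq.1 < pq.2 ∧ pq.2 ≤ n ∧ Odd (pq.1 + pq.2) ∧ Mc pq.1 pq.2 ∧ ¬ Lc pq.1 pq.2 ∧ Rc pq.1 pq.2 ∧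
      ∃ k, pq.1 < k ∧ k < pq.2 ∧ Even (pq.1 + k) ∧ Mc pq.1 k ∧ Lc pq.1 k ∧ Rc pq.1 k ∧ (Sl pq.1 k ↔ Sl pq.1 pq.2) ∧
        ∀ o, k < o → o < pq.2 → Mc pq.1 o → (Sl pq.1 o ↔ Sl pq.1 pq.2) → ¬ Rc pq.1 o) with hMsk
  -- «not the last flip of its slot»
  set NL : ℕ × ℕ → Prop := fun pq => ∃ q', pq.2 < q' ∧ q' ≤ n ∧ Mc pq.1 q' ∧ (Sl pq.1 q' ↔ Sl pq.1 pq.2) ∧ Rc pq.1 q' with hNL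
  -- (i) hops that are NOT the last flip: injection into jumps ∪ masked⁺ by «next flip of the slot»
  have hmemHop : ∀ pq, pq ∈ Hop ↔ pq ∈ P ∧ pq.1 < pq.2 ∧ pq.2 ≤ n ∧ Even (pq.1 + pq.2) ∧ Mc pq.1 pq.2 ∧ Lc pq.1 pq.2 ∧ Rc pq.1 pq.2 := by
    intro pq; rw [hHop, mem_filter]
  let g : ℕ × ℕ → ℕ × ℕ := fun pq => if h : NL pq then (pq.1, Nat.find h) else pq
  have hg_spec : ∀ pq, pq ∈ Hop → ∀ h : NL pq, g pq = (pq.1, Nat.find h) ∧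
      pq.2 < Nat.find h ∧ Nat.find h ≤ n ∧ Mc pq.1 (Nat.find h) ∧ (Sl pq.1 (Nat.find h) ↔ Sl pq.1 pq.2) ∧ Rc pq.1 (Nat.find h) ∧
      (∀ o, pq.2 < o → o < Nat.find h → Mc pq.1 o → (Sl pq.1 o ↔ Sl pq.1 pq.2) → ¬ Rc pq.1 o) := by
    intro pq _ h
    refine ⟨by simp only [g, dif_pos h], ?_⟩
    obtain ⟨h1, h2, h3, h4, h5⟩ := (Nat.find_spec h : pq.2 < Nat.find h ∧ Nat.find h ≤ n ∧ Mc pq.1 (Nat.find h) ∧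
      (Sl pq.1 (Nat.find h) ↔ Sl pq.1 pq.2) ∧ Rc pq.1 (Nat.find h))
    refine ⟨h1, h2, h3, h4, h5, fun o ho1 ho2 hMo hso hRo => ?_⟩
    exact Nat.find_min h ho2 ⟨ho1, by omega, hMo, hso, hRo⟩
  have hmaps : ∀ pq ∈ Hop.filter NL, g pq ∈ Jump ∪ Msk := by
    intro pq hpq
    rw [mem_filter] at hpq
    obtain ⟨hH, hnl⟩ := hpq
    obtain ⟨hPm, hlt, hqn, hev, hM, hL, hR⟩ := (hmemHop pq).mp hH
    obtain ⟨hgeq, h1, h2, h3, h4, h5, hminq⟩ := hg_spec pq hH hnl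
    set qs := Nat.find hnl with hqs
    have hpn : pq.1 ≤ n := by omega
    -- alternation: `qs` has the other parity
    have hpar : ¬ (Even qs ↔ Even pq.2) :=
      parity_ne_of_nextFlip a b n pq.1 pq.2 qs hslope hgp ⟨hlt, hqn, hM⟩ ⟨by omega, h2, h3⟩ h1 h4.symm hR
        (fun o hpo hoq hko hMo hso => hminq o hko hoq hMo (hso.trans h4))
    have hev2 : Even (pq.1 + pq.2) := hev
    rw [Nat.even_add] at hev
    have e1 : (Even qs ↔ ¬ Even pq.2) := by
      constructor
      · intro hq he2; exact hpar ⟨fun _ => he2, fun _ => hq⟩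
      · intro hne2; by_contra hq; exact hpar ⟨fun h => absurd h hq, fun h => absurd h hne2⟩
    have hodd : Odd (pq.1 + qs) := by
      rw [Nat.odd_add]
      constructor
      · intro ho1
        have hne1 : ¬ Even pq.1 := Nat.not_even_iff_odd.mpr ho1
        exact e1.mpr (fun he2 => hne1 (hev.mpr he2))
      · intro hqe
        have hne2 := e1.mp hqe
        exact Nat.not_even_iff_odd.mp (fun he1 => hne2 (hev.mp he1))
    rw [hgeq, mem_union]
    by_cases hLq : Lc pq.1 qs
    · left
      rw [hJump, mem_filter, hP, mem_product, mem_range, mem_range]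
      exact ⟨⟨by omega, by omega⟩, by omega, h2, hodd, h3, hLq, h5⟩
    · right
      rw [hMsk, mem_filter, hP, mem_product, mem_range, mem_range]
      exact ⟨⟨by omega, by omega⟩, by omega, h2, hodd, h3, hLq, h5, pq.2, hlt, h1, hev2, hM, hL, hR, h4.symm,
        fun o ho1 ho2 hMo hso => hminq o ho1 ho2 hMo (hso.trans h4)⟩
  have hinj : Set.InjOn g ↑(Hop.filter NL) := by
    rintro ⟨p, q⟩ hpq ⟨p', q'⟩ hpq' heq
    rw [mem_coe, mem_filter] at hpq hpq'
    obtain ⟨hH, hnl⟩ := hpq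
    obtain ⟨hH', hnl'⟩ := hpq'
    obtain ⟨-, hlt, hqn, -, hM, -, hR⟩ := (hmemHop _).mp hH
    obtain ⟨-, hlt', hqn', -, hM', -, hR'⟩ := (hmemHop _).mp hH'
    obtain ⟨hgeq, h1, h2, h3, h4, h5, hminq⟩ := hg_spec _ hH hnl
    obtain ⟨hgeq', h1', h2', h3', h4', h5', hminq'⟩ := hg_spec _ hH' hnl'
    rw [hgeq, hgeq'] at heq
    simp only [Prod.mk.injEq] at heq
    obtain ⟨hpp, hqq⟩ := heq
    subst hpp
    simp only at h1 h2 h3 h4 h5 hminq h1' h2' h3' h4' h5' hminq' hlt hlt' hM hM' hR hR' hqq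
    rcases lt_trichotomy q q' with hl | he | hl
    · exfalso
      have e : (Sl p q' ↔ Sl p q) := by
        have e' : (Sl p q' ↔ Sl p (Nat.find hnl')) := h4'.symm
        rw [← hqq] at e'
        exact e'.trans h4
      exact hminq q' hl (by rw [hqq]; exact h1') hM' e hR'
    · rw [he]
    · exfalso
      have e : (Sl p q ↔ Sl p q') := by
        have e' : (Sl p q ↔ Sl p (Nat.find hnl)) := h4.symm
        rw [hqq] at e'
        exact e'.trans h4'
      exact hminq' q hl (by rw [← hqq]; exact h1) hM e hR
  have hNL_le : (Hop.filter NL).card ≤ Jump.card + Msk.card :=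
    (card_le_card_of_injOn g hmaps hinj).trans (card_union_le _ _)
  -- (ii) hops that ARE the last flip of their slot: at most one per (line, slot)
  let s : ℕ × ℕ → ℕ × ℕ := fun pq => (pq.1, if Sl pq.1 pq.2 then 0 else 1)
  have hmaps2 : ∀ pq ∈ Hop.filter (fun pq => ¬ NL pq), s pq ∈ (range (n + 1)) ×ˢ (range 2) := by
    intro pq hpq
    rw [mem_filter] at hpq
    obtain ⟨hPm, hlt, hqn, -⟩ := (hmemHop pq).mp hpq.1
    simp only [s, mem_product, mem_range]
    refine ⟨by omega, ?_⟩
    split_ifs <;> omega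
  have hinj2 : Set.InjOn s ↑(Hop.filter (fun pq => ¬ NL pq)) := by
    rintro ⟨p, q⟩ hpq ⟨p', q'⟩ hpq' heq
    rw [mem_coe, mem_filter] at hpq hpq'
    obtain ⟨hH, hnl⟩ := hpq
    obtain ⟨hH', hnl'⟩ := hpq'
    obtain ⟨-, hlt, hqn, -, hM, -, hR⟩ := (hmemHop _).mp hH
    obtain ⟨-, hlt', hqn', -, hM', -, hR'⟩ := (hmemHop _).mp hH'
    simp only [s, Prod.mk.injEq] at heq
    obtain ⟨hpp, hss⟩ := heq
    subst hpp
    simp only at hlt hlt' hqn hqn' hM hM' hR hR' hnl hnl' hss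
    have hsl : (Sl p q ↔ Sl p q') := by
      by_cases h1 : Sl p q <;> by_cases h2 : Sl p q'
      · exact ⟨fun _ => h2, fun _ => h1⟩
      · rw [if_pos h1, if_neg h2] at hss; exact absurd hss (by norm_num)
      · rw [if_neg h1, if_pos h2] at hss; exact absurd hss (by norm_num)
      · exact ⟨fun h => absurd h h1, fun h => absurd h h2⟩
    rcases lt_trichotomy q q' with hl | he | hl
    · exact absurd ⟨q', hl, hqn', hM', hsl.symm, hR'⟩ hnl
    · rw [he]
    · exact absurd ⟨q, hl, hqn, hM, hsl, hR⟩ hnl'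
  have hL_le : (Hop.filter (fun pq => ¬ NL pq)).card ≤ 2 * (n + 1) := by
    have h := card_le_card_of_injOn s hmaps2 hinj2
    rw [card_product, card_range, card_range] at h
    linarith
  -- conclusion
  have htot := Finset.card_filter_add_card_filter_not (s := Hop) NL
  omega

/-- **`#hops ≤ 4n + 2 + #masked⁺`** (slot alternation + THEOREM T `mixedEvents_card_le`: jumps ≤ 2n): the ORDER QUESTION «hops = O(n)» would
follow from «masked⁺ = O(n)». [folklore] -/
theorem hops_le_masked (n : ℕ)
    (hslope : ∀ u v, u ≤ n → v ≤ n → u ≠ v → a u ≠ a v)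
    (hgp : ∀ u v t, u ≤ n → v ≤ n → t ≤ n → u ≠ v → t ≠ u → t ≠ v →
      L a b t ((b v - b u) / (a u - a v)) ≠ L a b u ((b v - b u) / (a u - a v))) :
    (((range (n + 1)) ×ˢ (range (n + 1))).filter (fun pq : ℕ × ℕ => pq.1 < pq.2 ∧ pq.2 ≤ n ∧ Even (pq.1 + pq.2) ∧
        (∀ t, pq.1 < t → t < pq.2 → 0 < gap t (L a b pq.1 ((b pq.2 - b pq.1) / (a pq.1 - a pq.2))) (L a b t ((b pq.2 - b pq.1) / (a pq.1 - a pq.2)))) ∧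
        (∃ r, Even r ∧ r ≤ pq.1 ∧ (∀ t, pq.1 - r ≤ t → t < pq.1 → 0 < gap t (L a b pq.1 ((b pq.2 - b pq.1) / (a pq.1 - a pq.2))) (L a b t ((b pq.2 - b pq.1) / (a pq.1 - a pq.2)))) ∧ (r = pq.1 ∨ ¬ 0 < gap (pq.1 - r - 1) (L a b pq.1 ((b pq.2 - b pq.1) / (a pq.1 - a pq.2))) (L a b (pq.1 - r - 1) ((b pq.2 - b pq.1) / (a pq.1 - a pq.2))))) ∧
        (∃ r, Even r ∧ pq.2 + r ≤ n ∧ (∀ t, pq.2 < t → t ≤ pq.2 + r → 0 < gap t (L a b pq.1 ((b pq.2 - b pq.1) / (a pq.1 - a pq.2))) (L a b t ((b pq.2 - b pq.1) / (a pq.1 - a pq.2)))) ∧ (pq.2 + r = n ∨ ¬ 0 < gap (pq.2 + r + 1) (L a b pq.1 ((b pq.2 - b pq.1) / (a pq.1 - a pq.2))) (L a b (pq.2 + r + 1) ((b pq.2 - b pq.1) / (a pq.1 - a pq.2))))))).card ≤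
      4 * n + 2 + (((range (n + 1)) ×ˢ (range (n + 1))).filter (fun pq : ℕ × ℕ => pq.1 < pq.2 ∧ pq.2 ≤ n ∧ Odd (pq.1 + pq.2) ∧
        (∀ t, pq.1 < t → t < pq.2 → 0 < gap t (L a b pq.1 ((b pq.2 - b pq.1) / (a pq.1 - a pq.2))) (L a b t ((b pq.2 - b pq.1) / (a pq.1 - a pq.2)))) ∧
        ¬ (∃ r, Even r ∧ r ≤ pq.1 ∧ (∀ t, pq.1 - r ≤ t → t < pq.1 → 0 < gap t (L a b pq.1 ((b pq.2 - b pq.1) / (a pq.1 - a pq.2))) (L a b t ((b pq.2 - b pq.1) / (a pq.1 - a pq.2)))) ∧ (r = pq.1 ∨ ¬ 0 < gap (pq.1 - r - 1) (L a b pq.1 ((b pq.2 - b pq.1) / (a pq.1 - a pq.2))) (L a b (pq.1 - r - 1) ((b pq.2 - b pq.1) / (a pq.1 - a pq.2))))) ∧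
        (∃ r, Even r ∧ pq.2 + r ≤ n ∧ (∀ t, pq.2 < t → t ≤ pq.2 + r → 0 < gap t (L a b pq.1 ((b pq.2 - b pq.1) / (a pq.1 - a pq.2))) (L a b t ((b pq.2 - b pq.1) / (a pq.1 - a pq.2)))) ∧ (pq.2 + r = n ∨ ¬ 0 < gap (pq.2 + r + 1) (L a b pq.1 ((b pq.2 - b pq.1) / (a pq.1 - a pq.2))) (L a b (pq.2 + r + 1) ((b pq.2 - b pq.1) / (a pq.1 - a pq.2))))) ∧
        ∃ k, pq.1 < k ∧ k < pq.2 ∧ Even (pq.1 + k) ∧ (∀ t, pq.1 < t → t < k → 0 < gap t (L a b pq.1 ((b k - b pq.1) / (a pq.1 - a k))) (L a b t ((b k - b pq.1) / (a pq.1 - a k)))) ∧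
          (∃ r, Even r ∧ r ≤ pq.1 ∧ (∀ t, pq.1 - r ≤ t → t < pq.1 → 0 < gap t (L a b pq.1 ((b k - b pq.1) / (a pq.1 - a k))) (L a b t ((b k - b pq.1) / (a pq.1 - a k)))) ∧ (r = pq.1 ∨ ¬ 0 < gap (pq.1 - r - 1) (L a b pq.1 ((b k - b pq.1) / (a pq.1 - a k))) (L a b (pq.1 - r - 1) ((b k - b pq.1) / (a pq.1 - a k))))) ∧
          (∃ r, Even r ∧ k + r ≤ n ∧ (∀ t, k < t → t ≤ k + r → 0 < gap t (L a b pq.1 ((b k - b pq.1) / (a pq.1 - a k))) (L a b t ((b k - b pq.1) / (a pq.1 - a k)))) ∧ (k + r = n ∨ ¬ 0 < gap (k + r + 1) (L a b pq.1 ((b k - b pq.1) / (a pq.1 - a k))) (L a b (k + r + 1) ((b k - b pq.1) / (a pq.1 - a k))))) ∧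
          ((0 < (if Even k then a k - a pq.1 else a pq.1 - a k)) ↔ (0 < (if Even pq.2 then a pq.2 - a pq.1 else a pq.1 - a pq.2))) ∧
          ∀ o, k < o → o < pq.2 → (∀ t, pq.1 < t → t < o → 0 < gap t (L a b pq.1 ((b o - b pq.1) / (a pq.1 - a o))) (L a b t ((b o - b pq.1) / (a pq.1 - a o)))) → ((0 < (if Even o then a o - a pq.1 else a pq.1 - a o)) ↔ (0 < (if Even pq.2 then a pq.2 - a pq.1 else a pq.1 - a pq.2))) → ¬ (∃ r, Even r ∧ o + r ≤ n ∧ (∀ t, o < t → t ≤ o + r → 0 < gap t (L a b pq.1 ((b o - b pq.1) / (a pq.1 - a o))) (L a b t ((b o - b pq.1) / (a pq.1 - a o)))) ∧ (o + r = n ∨ ¬ 0 < gap (o + r + 1) (L a b pq.1 ((b o - b pq.1) / (a pq.1 - a o))) (L a b (o + r + 1) ((b o - b pq.1) / (a pq.1 - a o))))))).card := by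
  have h1 := hops_le_jumps_add_masked a b n hslope hgp
  have hT := mixedEvents_card_le a b n hslope hgp
  omega

end

end StaticPathFold

end Summit.ValiantsHypothesis.ValiantsHypothesis.Theorems.KPlusLogSqLaw
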